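import Literature.MathematicalPhysics.QuantumLattice.EmeryThreeBandBlock2x2BoostDictionary
import Literature.MathematicalPhysics.QuantumLattice.HubbardTTPrimeGrandCanonicalPressure
import Literature.MathematicalPhysics.QuantumLattice.SectorPartitionFnCut
import Literature.MathematicalPhysics.QuantumLattice.HubbardTTPrimeThermalPressureZeemanBrackets
import HarnessLib

/-!
# The three-band `T > 0` CAP at `k = 2` from KERNEL SECTOR FLOORS: `4·emeryCellPressure β θ ≤ log Σ_{p,p' ≤ 12} C(12,p) C(12,p') e^{−β q_{p+p'}}`

Topic `Literature/MathematicalPhysics/QuantumLattice` (family `hubbard`; crew hubbard-fast S2 «multi-band × T > 0», seat hubbard-box-p1). The one-line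
composition of the boosted block dictionary (`EmeryThreeBandBlock2x2BoostDictionary.emeryCellPressure_le_log_partitionFn_boostGP`) with the
sector-floor cap (the argument of `PartitionFnSectorFloorCap.log_partitionFn_hubbardOpenBoxGP_le_of_sector_floors`, re-run here for this cluster): kernel certificates `q_k ≤ E₀(h^G_boost(θ), k)`,
`k ≤ 24`, of the BOOSTED `Cu₄O₈` general-pair cluster `h^G_boost(θ) = hubbardOpenBoxGP 1 12 (boostTau θ) (blockUps θ) (blockNu θ)` (the conclusion shape of
hubbard-box-p2's `groundEnergy_ge_of_kCertsGP₃`) give a certified CAP on the three-band pressure per `CuO₂` — with the Rayleigh-family FLOOR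
(`le_emeryCellPressure_of_rayleighFamily`) the first TWO-SIDED `T > 0` three-band window producible entirely by the existing kernel devices.

Everything is PROVED (0 sorry); no definition, no named fact, no number. HONEST SCOPE: the crude «T = 0 sector floors + full sector entropies» cap.

## References

* D. Ruelle, *Statistical Mechanics: Rigorous Results* (1969), §3.4. [cite: Ruelle1969, §3.4]
* R. B. Israel, *Convexity in the Theory of Lattice Gases* (1979), Lemma II.3.1. [cite: Israel1979, Lemma II.3.1]
-/

noncomputable section

open scoped ComplexOrder BigOperators
open Finset

namespace Literature.MathematicalPhysics.QuantumLattice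

open Matrix HubbardWave0 LiebThm1 ThermodynamicLimit ClusterLowerBound

/-- **The sector-floor cap for the boosted `Cu₄O₈` general-pair cluster** (`β ≥ 0`): floors `q_k ≤ E₀(h^G_boost(θ), k)` for all `k ≤ 24` give
`log Re Z_β(h^G_boost(θ)) ≤ log Σ_{p,p' ≤ 12} C(12,p)·C(12,p')·e^{−β q_{p+p'}}`. [cite: Ruelle1969, §3.4] [cite: Israel1979, Lemma II.3.1] -/
theorem log_partitionFn_boostGP_le_of_sector_floors {β : ℝ} (hβ : 0 ≤ β) (θ : Fin 14 → ℝ) {q : ℕ → ℝ}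
    (hq : ∀ k ≤ 2 * (1 * 12), q k ≤ groundEnergy (hubbardOpenBoxGP 1 12 (boostTau θ) (blockUps θ) (blockNu θ)) k) :
    Real.log (Matrix.partitionFn β (hubbardOpenBoxGP 1 12 (boostTau θ) (blockUps θ) (blockNu θ))).re ≤
      Real.log (∑ p ∈ Finset.range (1 * 12 + 1), ∑ p' ∈ Finset.range (1 * 12 + 1),
        (((1 * 12).choose p * (1 * 12).choose p' : ℕ) : ℝ) * Real.exp (-(β * q (p + p')))) := by
  set A := hubbardOpenBoxGP 1 12 (boostTau θ) (blockUps θ) (blockNu θ) with hAdef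
  have hA : A.IsHermitian := hubbardOpenBoxGP_isHermitian _ (boostTau_symm θ) _ _
  have hP : PreservesSectors A := preservesSectors_hubbardOpenBoxGP _ _ _
  have hcard : Fintype.card (Fin 1 ×ₗ Fin 12) = 1 * 12 := card_rectSites 1 12
  haveI : Nonempty (Finset (Orb (Fin 1 ×ₗ Fin 12))) := ⟨∅⟩
  -- one sector: every eigenvalue of `A|_{(a,b)}` is `≥ E₀(A, a+b) ≥ q_{a+b}` (its zero-extended eigenvector is a unit `(a+b)`-particle vector)
  have hsec : ∀ a b : ℕ, a + b ≤ 2 * (1 * 12) →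
      (Matrix.partitionFn β (spinSectorHamiltonian a b A)).re ≤ (((1 * 12).choose a * (1 * 12).choose b : ℕ) : ℝ) * Real.exp (-(β * q (a + b))) := by
    intro a b hab
    have hinv : ∀ s s' : Finset (Orb (Fin 1 ×ₗ Fin 12)), ¬ spinConfig a b s → spinConfig a b s' → A s s' = 0 :=
      fun s s' hs hs' => apply_eq_zero_of_preservesSectors hP a b s s' hs hs'
    have hev : ∀ c : Subtype (spinConfig (Λ := Fin 1 ×ₗ Fin 12) a b), q (a + b) ≤ sectorEigenvalue (spinConfig a b) A hA c := by
      intro c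
      have hsupp : IsInSector a b (sectorEigenvector (spinConfig a b) A hA c) :=
        (isInSector_iff_support a b _).2 fun s hs => sectorEigenvector_apply_of_not_mem (spinConfig a b) A hA c hs
      have h := LiebThm1.groundEnergy_le_re_expect A hsupp.isNParticle (star_sectorEigenvector_dotProduct_self (spinConfig a b) A hA c)
      rw [expect, re_rayleigh_sectorEigenvector (spinConfig a b) hA hinv c] at h
      exact (hq (a + b) hab).trans h
    rw [partitionFn_spinSectorHamiltonian_re a b hA β]
    calc ∑ c, Real.exp (-(β * sectorEigenvalue (spinConfig a b) A hA c))
        ≤ ∑ _c : Subtype (spinConfig (Λ := Fin 1 ×ₗ Fin 12) a b), Real.exp (-(β * q (a + b))) :=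
          Finset.sum_le_sum fun c _ => Real.exp_le_exp.2 (by nlinarith [hev c])
      _ = (Fintype.card (Subtype (spinConfig (Λ := Fin 1 ×ₗ Fin 12) a b)) : ℝ) * Real.exp (-(β * q (a + b))) := by
          rw [Finset.sum_const, Finset.card_univ, nsmul_eq_mul]
      _ ≤ _ := by
          refine mul_le_mul_of_nonneg_right ?_ (Real.exp_pos _).le
          have h := card_subtype_spinConfig_le_choose_mul_choose (Λ := Fin 1 ×ₗ Fin 12) a b
          rw [hcard] at h
          exact_mod_cast h
  have h0 : Matrix.partitionFn β A = Matrix.partitionFn β (A - ((0 : ℝ) : ℂ) • totalNumber) := by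
    rw [Complex.ofReal_zero, zero_smul, sub_zero]
  have hle : (Matrix.partitionFn β A).re ≤ ∑ p ∈ Finset.range (1 * 12 + 1), ∑ p' ∈ Finset.range (1 * 12 + 1),
      (((1 * 12).choose p * (1 * 12).choose p' : ℕ) : ℝ) * Real.exp (-(β * q (p + p'))) := by
    rw [h0, partitionFn_sub_smul_totalNumber_re_eq_sum hP β 0, hcard]
    refine Finset.sum_le_sum fun a ha => Finset.sum_le_sum fun b hb => ?_
    rw [mul_zero, zero_mul, Real.exp_zero, one_mul]
    have hak : a ≤ 1 * 12 := Nat.lt_succ_iff.1 (Finset.mem_range.1 ha)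
    have hbk : b ≤ 1 * 12 := Nat.lt_succ_iff.1 (Finset.mem_range.1 hb)
    exact hsec a b (by omega)
  exact Real.log_le_log (partitionFn_re_pos hA β) hle

/-- **THE DEVICE CAP FROM SECTOR FLOORS** (`β ≥ 0`): kernel floors `q_k ≤ E₀(hubbardOpenBoxGP 1 12 (boostTau θ) (blockUps θ) (blockNu θ), k)` for all
`k ≤ 24` give `4·emeryCellPressure β θ ≤ log Σ_{p ≤ 12} Σ_{p' ≤ 12} C(12,p)·C(12,p')·e^{−β q_{p+p'}}`. [cite: Ruelle1969, §3.4] [cite: Israel1979, Lemma II.3.1] -/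
theorem emeryCellPressure_le_of_boost_sector_floors {β : ℝ} (hβ : 0 ≤ β) (θ : Fin 14 → ℝ) {q : ℕ → ℝ}
    (hq : ∀ k ≤ 2 * (1 * 12), q k ≤ groundEnergy (hubbardOpenBoxGP 1 12 (boostTau θ) (blockUps θ) (blockNu θ)) k) :
    4 * emeryCellPressure β θ ≤
      Real.log (∑ p ∈ Finset.range (1 * 12 + 1), ∑ p' ∈ Finset.range (1 * 12 + 1),
        (((1 * 12).choose p * (1 * 12).choose p' : ℕ) : ℝ) * Real.exp (-(β * q (p + p')))) :=
  (emeryCellPressure_le_log_partitionFn_boostGP β θ).trans (log_partitionFn_boostGP_le_of_sector_floors hβ θ hq)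

/-- **Certified-number form**: if moreover the explicit sum is `≤ e^u`, then `emeryCellPressure β θ ≤ u/4`. [cite: Ruelle1969, §3.4] -/
theorem emeryCellPressure_le_of_boost_sector_floors_of_sum_le {β : ℝ} (hβ : 0 ≤ β) (θ : Fin 14 → ℝ) {q : ℕ → ℝ}
    (hq : ∀ k ≤ 2 * (1 * 12), q k ≤ groundEnergy (hubbardOpenBoxGP 1 12 (boostTau θ) (blockUps θ) (blockNu θ)) k) {u : ℝ}
    (hu : ∑ p ∈ Finset.range (1 * 12 + 1), ∑ p' ∈ Finset.range (1 * 12 + 1),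
        (((1 * 12).choose p * (1 * 12).choose p' : ℕ) : ℝ) * Real.exp (-(β * q (p + p'))) ≤ Real.exp u) :
    emeryCellPressure β θ ≤ u / 4 := by
  have hpos : 0 < ∑ p ∈ Finset.range (1 * 12 + 1), ∑ p' ∈ Finset.range (1 * 12 + 1),
      (((1 * 12).choose p * (1 * 12).choose p' : ℕ) : ℝ) * Real.exp (-(β * q (p + p'))) := by
    refine Finset.sum_pos (fun p hp => Finset.sum_pos (fun p' hp' => ?_) ⟨0, by simp⟩) ⟨0, by simp⟩
    have hp12 : p ≤ 12 := by have := Finset.mem_range.1 hp; omega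
    have hp12' : p' ≤ 12 := by have := Finset.mem_range.1 hp'; omega
    have hc : 0 < (1 * 12).choose p * (1 * 12).choose p' := Nat.mul_pos (Nat.choose_pos (by omega)) (Nat.choose_pos (by omega))
    exact mul_pos (by exact_mod_cast hc) (Real.exp_pos _)
  have h := (emeryCellPressure_le_of_boost_sector_floors hβ θ hq).trans ((Real.log_le_log hpos hu).trans (le_of_eq (Real.log_exp u)))
  linarith

end Literature.MathematicalPhysics.QuantumLattice

end
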